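import Summits.KontsevichZagierPeriods.KontsevichZagierPeriods.Theorems.LinRedNormalFormArrangementNormalFormStubRebaseSimpleZeroTwoInterval
import Summits.KontsevichZagierPeriods.KontsevichZagierPeriods.Theorems.LinRedNormalFormArrangementNormalFormStubRebaseSimpleZeroNestedDiffInterval
import Summits.KontsevichZagierPeriods.KontsevichZagierPeriods.Theorems.LinRedNormalFormArrangementNormalFormStubRebaseSimpleZeroNestedSuper

/-!
# Stub `stub_rebaseSimpleZeroTwo`, part `rebaseSimpleZero_HDiff1_of_HPar1` (crux
`ArrangementNormalForm`, line `janus-bands`) — brick `NestedDiffE1Tools`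

The interval normal form `HDiff₁` of the two-fibre rebase (`rebaseSimpleZeroTwo_of_intervalGGset`:
clean nest `A(y) < tᵢ < tⱼ < B(y)` over a literal rational interval `{l < y < u}`, inner letter
constant, outer letter of non-zero `y`-slope, base pole outside the open interval) is to be
reduced to its sub-case `HPar1` (one bound parallel to the letter of its own fibre) by BOX-JANUS
dissections. This brick sets up the bookkeeping:
* `RebaseE1.IsDN` — the datum of `HDiff₁` as a structure, `RebaseE1.HParS` — the hypothesis
  `HPar1` on such data, `RebaseE1.LData` — the fixed letter data;
* `RebaseE1.three_piece` — rule (1a) on a nest `X < tᵢ < tⱼ < Z` by an intermediate section `Y`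
  (`X ≤ Y ≤ Z` on the base cell): `[X<tᵢ<tⱼ<Z] = [X<tᵢ<tⱼ<Y] + [X<tᵢ<Y]×[Y<tⱼ<Z] + [Y<tᵢ<tⱼ<Z]`;
* the interval cut `IsDN.good_split` and bounded-integrand convergence `integrableOn_of_abs_le`.
The three uses of the dissection (interior cut, sub- and super-section Janus) are brick
`NestedDiffE1Janus`.

References: M. Kontsevich, D. Zagier, *Periods* (2001), §1.2, rules (1a), (2).
-/

noncomputable section

open Set MeasureTheory MvPolynomial
open Literature.NumberTheory.Transcendental Literature.ModelTheory.ExponentialFields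

namespace Summit.KontsevichZagierPeriods.ArrangementNormalForm.JanusBands

namespace RebaseE1

open SeparatePos RebasePos RebaseZero RebaseNest RebaseDiff

variable {m' : ℕ} {i j : Fin 2}

/-! ### Points of the three-space -/

/-- The point with base `y`, fibre `i` at `ti` and fibre `j` at `tj`. -/
def pt (i j : Fin 2) (y ti tj : ℝ) : Fin (0 + 1 + 2) → ℝ :=
  Function.update (Function.update (fun _ => y) (tIdx i) ti) (tIdx j) tj

/-- The base of `pt`. -/
@[simp] theorem yv_pt (y ti tj : ℝ) : yv (pt i j y ti tj) = y := by
  simp only [yv, pt, Function.update_of_ne (yIdx_ne_tIdx j), Function.update_of_ne (yIdx_ne_tIdx i)]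

/-- The inner fibre of `pt`. -/
theorem tv_pt_i (hij : i ≠ j) (y ti tj : ℝ) : tv (pt i j y ti tj) i = ti := by
  simp only [tv, pt, Function.update_of_ne (tIdx_injective.ne hij), Function.update_self]

/-- The outer fibre of `pt`. -/
@[simp] theorem tv_pt_j (y ti tj : ℝ) : tv (pt i j y ti tj) j = tj := by
  simp only [tv, pt, Function.update_self]

/-! ### Bounded integrands converge -/

/-- A semialgebraic function bounded on a bounded semialgebraic set is integrable there.
[folklore] -/
theorem integrableOn_of_abs_le {n : ℕ} {D : Set (Fin n → ℝ)} (hD : IsSemialgebraic ℚ D)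
    (hbd : Bornology.IsBounded D) {f : (Fin n → ℝ) → ℝ} (hf : IsSemialgebraicFunOn ℚ D f) (C : ℝ)
    (hC : ∀ z ∈ D, |f z| ≤ C) : IntegrableOn f D := by
  have hDm : MeasurableSet D := IsSemialgebraic.measurableSet_holds hD
  have hc : IntegrableOn (fun _ : Fin n → ℝ => C) D := integrableOn_const hbd.measure_lt_top.ne
  refine Integrable.mono' hc (KZ.aestronglyMeasurable_of_isSemialgebraicFunOn hf hDm)
    ((ae_restrict_iff' hDm).2 (Filter.Eventually.of_forall fun z hz => ?_))
  rw [Real.norm_eq_abs]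
  exact hC z hz

/-! ### The three-piece dissection -/

/-- **Rule (1a) on a nest by an intermediate section.** For a representation `W` on the nest
`X < tᵢ < tⱼ < Z` over the base cell `cell M` and a section `Y` with `X ≤ Y ≤ Z` on the cell,
`[W] = [W|X<tᵢ<tⱼ<Y] + [W|{X<tᵢ<Y}×{Y<tⱼ<Z}] + [W|Y<tᵢ<tⱼ<Z]` modulo `KZ.relations` (the ties
`tᵢ = Y`, `tⱼ = Y` are null). [Kontsevich–Zagier 2001, §1.2, rule (1)] -/
theorem three_piece (W : KZ.IntegralRep (0 + 1 + 2)) (M : Fin m' → Cf) (hij : i ≠ j) (X Y Z : Cf)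
    (hW : W.domain = gDom 0 2 m' M (nlo i X) (nhi j Z))
    (hXY : ∀ y ∈ cell M, ev X y ≤ ev Y y) (hYZ : ∀ y ∈ cell M, ev Y y ≤ ev Z y) :
    ∃ r₁ r₂ r₃ : KZ.IntegralRep (0 + 1 + 2),
      (r₁.domain = gDom 0 2 m' M (nlo i X) (nhi j Y) ∧ r₁.integrand = W.integrand) ∧
      (r₂.domain = pDom M (fun l => if l = i then X else Y) (fun l => if l = i then Y else Z) ∧
        r₂.integrand = W.integrand) ∧
      (r₃.domain = gDom 0 2 m' M (nlo i Y) (nhi j Z) ∧ r₃.integrand = W.integrand) ∧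
      KZ.of W - KZ.of r₁ - KZ.of r₂ - KZ.of r₃ ∈ KZ.relations := by
  classical
  set D₁ := gDom 0 2 m' M (nlo i X) (nhi j Y) with hD₁
  set U : Fin 2 → Cf := fun l => if l = i then X else Y with hU
  set V : Fin 2 → Cf := fun l => if l = i then Y else Z with hV
  set D₂ := pDom M U V with hD₂
  set D₃ := gDom 0 2 m' M (nlo i Y) (nhi j Z) with hD₃
  have mW : ∀ z, z ∈ W.domain ↔ yv z ∈ cell M ∧ ev X (yv z) < tv z i ∧ tv z i < tv z j ∧
      tv z j < ev Z (yv z) := fun z => by rw [hW, mem_nDom hij]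
  have m₁ : ∀ z, z ∈ D₁ ↔ yv z ∈ cell M ∧ ev X (yv z) < tv z i ∧ tv z i < tv z j ∧
      tv z j < ev Y (yv z) := fun z => by rw [hD₁, mem_nDom hij]
  have m₃ : ∀ z, z ∈ D₃ ↔ yv z ∈ cell M ∧ ev Y (yv z) < tv z i ∧ tv z i < tv z j ∧
      tv z j < ev Z (yv z) := fun z => by rw [hD₃, mem_nDom hij]
  have m₂ : ∀ z, z ∈ D₂ ↔ yv z ∈ cell M ∧ (ev X (yv z) < tv z i ∧ tv z i < ev Y (yv z)) ∧
      (ev Y (yv z) < tv z j ∧ tv z j < ev Z (yv z)) := fun z => by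
    rw [hD₂, mem_pDom, forall_fin_two_iff hij]
    simp only [hU, hV, if_pos rfl, if_neg hij.symm]
  -- inclusions
  have s₁ : D₁ ⊆ W.domain := fun z hz => by
    obtain ⟨hy, h1, h2, h3⟩ := (m₁ z).1 hz
    exact (mW z).2 ⟨hy, h1, h2, h3.trans_le (hYZ _ hy)⟩
  have s₂ : D₂ ⊆ W.domain := fun z hz => by
    obtain ⟨hy, ⟨h1, h2⟩, h3, h4⟩ := (m₂ z).1 hz
    exact (mW z).2 ⟨hy, h1, h2.trans h3, h4⟩
  have s₃ : D₃ ⊆ W.domain := fun z hz => by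
    obtain ⟨hy, h1, h2, h3⟩ := (m₃ z).1 hz
    exact (mW z).2 ⟨hy, (hXY _ hy).trans_lt h1, h2, h3⟩
  set r₁ := W.restrict D₁ (isSemialgebraic_gDom _ _ _ _) s₁ with hr₁
  set r₂ := W.restrict D₂ (isSemialgebraic_pDom _ _ _) s₂ with hr₂
  set r₃ := W.restrict D₃ (isSemialgebraic_gDom _ _ _ _) s₃ with hr₃
  set Rr : Fin 3 → KZ.IntegralRep (0 + 1 + 2) := ![r₁, r₂, r₃] with hRr
  have hRsub : ∀ k, (Rr k).domain ⊆ W.domain := by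
    intro k; fin_cases k; exacts [s₁, s₂, s₃]
  -- the ties are null
  have hNull : volume ({z : Fin (0 + 1 + 2) → ℝ | tv z i = ev Y (yv z)} ∪
      {z | tv z j = ev Y (yv z)}) = 0 :=
    measure_union_null (volume_tv_eq_ev i Y) (volume_tv_eq_ev j Y)
  have hcov : W.domain \ (⋃ k ∈ (Finset.univ : Finset (Fin 3)), (Rr k).domain) ⊆
      {z : Fin (0 + 1 + 2) → ℝ | tv z i = ev Y (yv z)} ∪ {z | tv z j = ev Y (yv z)} := by
    rintro z ⟨hz, hzU⟩
    have hnot : ∀ k, z ∉ (Rr k).domain := fun k hk => hzU (mem_iUnion₂.2 ⟨k, Finset.mem_univ _, hk⟩)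
    obtain ⟨hy, h1, h2, h3⟩ := (mW z).1 hz
    rcases lt_trichotomy (tv z j) (ev Y (yv z)) with hj | hj | hj
    · exact absurd ((m₁ z).2 ⟨hy, h1, h2, hj⟩) (hnot 0)
    · exact Or.inr hj
    rcases lt_trichotomy (tv z i) (ev Y (yv z)) with hi | hi | hi
    · exact absurd ((m₂ z).2 ⟨hy, ⟨h1, hi⟩, hj, h3⟩) (hnot 1)
    · exact Or.inl hi
    · exact absurd ((m₃ z).2 ⟨hy, hi, h2, h3⟩) (hnot 2)
  -- the cells are disjoint
  have hdisj : ∀ k k' : Fin 3, k ≠ k' → (Rr k).domain ∩ (Rr k').domain = ∅ := by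
    have d12 : D₁ ∩ D₂ = ∅ := eq_empty_of_forall_notMem fun z ⟨hz, hz'⟩ => by
      linarith [((m₁ z).1 hz).2.2.2, ((m₂ z).1 hz').2.2.1]
    have d13 : D₁ ∩ D₃ = ∅ := eq_empty_of_forall_notMem fun z ⟨hz, hz'⟩ => by
      linarith [((m₁ z).1 hz).2.2.1, ((m₁ z).1 hz).2.2.2, ((m₃ z).1 hz').2.1]
    have d23 : D₂ ∩ D₃ = ∅ := eq_empty_of_forall_notMem fun z ⟨hz, hz'⟩ => by
      linarith [((m₂ z).1 hz).2.1.2, ((m₃ z).1 hz').2.1]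
    intro k k' hkk'
    fin_cases k <;> fin_cases k' <;> first | exact absurd rfl hkk' | exact d12 | exact d13 | exact d23 |
      (rw [inter_comm]; first | exact d12 | exact d13 | exact d23)
  -- rule (1a)
  have hrel : KZ.of W - ∑ k, KZ.of (Rr k) ∈ KZ.relations := by
    refine KZ.of_sub_sum_of_mem_relations Finset.univ W Rr (fun k _ => ?_) (fun k _ z _ => ?_)
      (measure_mono_null hcov hNull) (fun k _ k' _ hkk' => ?_)
    · rw [sdiff_eq_empty.2 (hRsub k), measure_empty]
    · fin_cases k <;> rfl
    · show volume ((Rr k).domain ∩ (Rr k').domain) = 0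
      rw [hdisj k k' hkk', measure_empty]
  refine ⟨r₁, r₂, r₃, ⟨rfl, rfl⟩, ⟨rfl, rfl⟩, ⟨rfl, rfl⟩, ?_⟩
  rw [Fin.sum_univ_three] at hrel
  convert hrel using 1
  simp only [hRr, Matrix.cons_val_zero, Matrix.cons_val_one, Matrix.cons_val_two, Matrix.head_cons,
    Matrix.tail_cons]
  abel

/-! ### The datum of `HDiff₁` -/

/-- The fixed letter data of `HDiff₁`: two distinct fibres `i, j` with letters `cᵢ` (constant) and
`cⱼ` (non-zero `y`-slope), and a simple base pole (`n₁ = 0`, `n₂ = 1`). [folklore] -/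
structure LData (T : BData) (a : Fin 2 → Option Cf) (i j : Fin 2) (ci cj : Cf) : Prop where
  /-- the two fibres -/
  ne : i ≠ j
  /-- the inner letter -/
  hi : a i = some ci
  /-- the outer letter -/
  hj : a j = some cj
  /-- the inner letter is constant -/
  ci0 : ci.1 (Fin.last 0) = 0
  /-- the outer letter has non-zero slope -/
  cj0 : cj.1 (Fin.last 0) ≠ 0
  /-- no numerator power of the base -/
  n1 : T.n₁ = 0
  /-- simple base pole -/
  n2 : T.n₂ = 1

/-- `s` is the datum of `HDiff₁`: the clean nest `A(y) < tᵢ < tⱼ < B(y)` over the literal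
rational interval `{l < y < u}` (`l < u`, non-empty fibres over the whole open interval), with
the literal integrand of base-factor data `T`, base pole `T.ℓ₂.2` outside the open interval,
bounded domain. [folklore] -/
structure IsDN (s : KZ.IntegralRep (0 + 1 + 2)) (l u : ℚ) (A B : Cf) (T : BData)
    (p : MvPolynomial (Fin 0) ℚ) (a : Fin 2 → Option Cf) (i j : Fin 2) : Prop where
  /-- the two fibres -/
  ne : i ≠ j
  /-- the domain is the clean nest over the interval -/
  dom : s.domain = gDom 0 2 2 ![RebaseZero.mk 1 (-l), RebaseZero.mk (-1) u] (nlo i A) (nhi j B)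
  /-- the integrand is the literal one -/
  int : EqOn s.integrand (glitB T p a) s.domain
  /-- bounded domain -/
  bdd : Bornology.IsBounded s.domain
  /-- a genuine interval -/
  lu : l < u
  /-- non-empty fibres -/
  AB : ∀ y : ℝ, (l : ℝ) < y → y < u → ev A y < ev B y
  /-- the base pole is outside the open interval -/
  pole : T.ℓ₂.2 ≤ l ∨ u ≤ T.ℓ₂.2

/-- **The hypothesis `HPar1` on structured data** (worker W14's theorem
`rebaseSimpleZero_nestedDiffHPar1`): every datum of `HDiff₁` one of whose bounds is parallel to
the letter of its own fibre (`A ∥ cᵢ` or `B ∥ cⱼ`) is good for `GG 0 2 2`.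
[Kontsevich–Zagier 2001, §1.2, rules (1a), (1b), (2)] -/
def HParS (T : BData) (p : MvPolynomial (Fin 0) ℚ) (a : Fin 2 → Option Cf) (i j : Fin 2) (ci cj : Cf) : Prop :=
  ∀ (s : KZ.IntegralRep (0 + 1 + 2)) (l u : ℚ) (A B : Cf), IsDN s l u A B T p a i j →
    (A.1 (Fin.last 0) = ci.1 (Fin.last 0) ∨ B.1 (Fin.last 0) = cj.1 (Fin.last 0)) → Good 2 (KZ.of s)

variable {s : KZ.IntegralRep (0 + 1 + 2)} {l u : ℚ} {A B : Cf} {T : BData} {p : MvPolynomial (Fin 0) ℚ}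
  {a : Fin 2 → Option Cf} {ci cj : Cf}

/-- Membership in the domain of the datum. -/
theorem IsDN.mem (h : IsDN s l u A B T p a i j) (z : Fin (0 + 1 + 2) → ℝ) : z ∈ s.domain ↔
    ((l : ℝ) < yv z ∧ yv z < u) ∧ ev A (yv z) < tv z i ∧ tv z i < tv z j ∧ tv z j < ev B (yv z) := by
  rw [h.dom, mem_nDom h.ne, mem_cell_Ioo]

/-- Membership in a nest over the interval. -/
theorem mem_nDom_Ioo (hij : i ≠ j) (l u : ℚ) (X Z : Cf) (z : Fin (0 + 1 + 2) → ℝ) :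
    z ∈ gDom 0 2 2 ![RebaseZero.mk 1 (-l), RebaseZero.mk (-1) u] (nlo i X) (nhi j Z) ↔
    ((l : ℝ) < yv z ∧ yv z < u) ∧ ev X (yv z) < tv z i ∧ tv z i < tv z j ∧ tv z j < ev Z (yv z) := by
  rw [mem_nDom hij, mem_cell_Ioo]

/-- The interval cell is bounded. -/
theorem cell_Ioo_bound (l u : ℚ) : ∀ y ∈ cell ![RebaseZero.mk 1 (-l), RebaseZero.mk (-1) u],
    |y| ≤ max |(l : ℝ)| |(u : ℝ)| := fun y hy => by
  obtain ⟨h1, h2⟩ := (mem_cell_Ioo l u y).1 hy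
  rw [abs_le]
  constructor
  · have := neg_abs_le (l : ℝ)
    have := le_max_left |(l : ℝ)| |(u : ℝ)|
    linarith
  · have := le_abs_self (u : ℝ)
    have := le_max_right |(l : ℝ)| |(u : ℝ)|
    linarith

/-- A nest over the interval is bounded. -/
theorem isBounded_nDom_Ioo (hij : i ≠ j) (l u : ℚ) (X Z : Cf) :
    Bornology.IsBounded (gDom 0 2 2 ![RebaseZero.mk 1 (-l), RebaseZero.mk (-1) u] (nlo i X) (nhi j Z)) :=
  isBounded_nDom _ (cell_Ioo_bound l u) hij X Z

/-- The side of the base pole. -/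
theorem IsDN.side (h : IsDN s l u A B T p a i j) :
    (∀ y ∈ cell ![RebaseZero.mk 1 (-l), RebaseZero.mk (-1) u], (T.ℓ₂.2 : ℝ) < y) ∨
      (∀ y ∈ cell ![RebaseZero.mk 1 (-l), RebaseZero.mk (-1) u], y < (T.ℓ₂.2 : ℝ)) := by
  rcases h.pole with hp | hp
  · refine Or.inl fun y hy => ?_
    have h' : (T.ℓ₂.2 : ℝ) ≤ l := by exact_mod_cast hp
    exact h'.trans_lt ((mem_cell_Ioo l u y).1 hy).1
  · refine Or.inr fun y hy => ?_
    have h' : (u : ℝ) ≤ T.ℓ₂.2 := by exact_mod_cast hp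
    exact ((mem_cell_Ioo l u y).1 hy).2.trans_le h'

/-- The base pole is off the open interval. -/
theorem IsDN.yv_ne (h : IsDN s l u A B T p a i j) {y : ℝ} (h1 : (l : ℝ) < y) (h2 : y < u) :
    y ≠ T.ℓ₂.2 := by
  rcases h.pole with hp | hp
  · have h' : (T.ℓ₂.2 : ℝ) ≤ l := by exact_mod_cast hp
    exact (h'.trans_lt h1).ne'
  · have h' : (u : ℝ) ≤ T.ℓ₂.2 := by exact_mod_cast hp
    exact (h2.trans_le h').ne

/-- The literal integrand converges absolutely on the domain of the datum. -/
theorem IsDN.integrableOn (h : IsDN s l u A B T p a i j) :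
    IntegrableOn (glitB T p a) (gDom 0 2 2 ![RebaseZero.mk 1 (-l), RebaseZero.mk (-1) u] (nlo i A) (nhi j B)) := by
  rw [← h.dom]
  exact s.integrableOn.congr_fun h.int (KZ.IntegralRep.measurableSet_domain_holds s)

/-- A representation with the domain and the integrand of the datum is the datum. -/
theorem IsDN.of_eq (h : IsDN s l u A B T p a i j) {r : KZ.IntegralRep (0 + 1 + 2)}
    (hd : r.domain = gDom 0 2 2 ![RebaseZero.mk 1 (-l), RebaseZero.mk (-1) u] (nlo i A) (nhi j B))
    (hi : EqOn r.integrand (glitB T p a) r.domain) : IsDN r l u A B T p a i j :=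
  ⟨h.ne, hd, hi, by rw [hd, ← h.dom]; exact h.bdd, h.lu, h.AB, h.pole⟩

/-- **Applying `HPar1`.** -/
theorem IsDN.good_par (h : IsDN s l u A B T p a i j) (hP : HParS T p a i j ci cj)
    (hpar : A.1 (Fin.last 0) = ci.1 (Fin.last 0) ∨ B.1 (Fin.last 0) = cj.1 (Fin.last 0)) :
    Good 2 (KZ.of s) :=
  hP s l u A B h hpar

/-! ### Cutting the interval -/

/-- **Cutting the base interval at a rational point** (rule 1a): if both pieces are good, so is
the datum. [Kontsevich–Zagier 2001, §1.2, rule (1)] -/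
theorem IsDN.good_split (h : IsDN s l u A B T p a i j) (q : ℚ) (hlq : l < q) (hqu : q < u)
    (h₁ : ∀ s₁ : KZ.IntegralRep (0 + 1 + 2), IsDN s₁ l q A B T p a i j → Good 2 (KZ.of s₁))
    (h₂ : ∀ s₂ : KZ.IntegralRep (0 + 1 + 2), IsDN s₂ q u A B T p a i j → Good 2 (KZ.of s₂)) :
    Good 2 (KZ.of s) := by
  have hij := h.ne
  set D₁ := gDom 0 2 2 ![RebaseZero.mk 1 (-l), RebaseZero.mk (-1) q] (nlo i A) (nhi j B) with hD₁
  set D₂ := gDom 0 2 2 ![RebaseZero.mk 1 (-q), RebaseZero.mk (-1) u] (nlo i A) (nhi j B) with hD₂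
  have m₁ := mem_nDom_Ioo hij l q A B
  have m₂ := mem_nDom_Ioo hij q u A B
  have hq1 : (l : ℝ) < q := by exact_mod_cast hlq
  have hq2 : (q : ℝ) < u := by exact_mod_cast hqu
  have hs₁ : D₁ ⊆ s.domain := fun z hz => by
    obtain ⟨⟨h1, h2⟩, h3⟩ := (m₁ z).1 hz
    exact (h.mem z).2 ⟨⟨h1, h2.trans hq2⟩, h3⟩
  have hs₂ : D₂ ⊆ s.domain := fun z hz => by
    obtain ⟨⟨h1, h2⟩, h3⟩ := (m₂ z).1 hz
    exact (h.mem z).2 ⟨⟨hq1.trans h1, h2⟩, h3⟩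
  have hdisj : D₁ ∩ D₂ = ∅ := eq_empty_of_forall_notMem fun z ⟨hz, hz'⟩ => by
    linarith [((m₁ z).1 hz).1.2, ((m₂ z).1 hz').1.1]
  have hNull : volume {z : Fin (0 + 1 + 2) → ℝ | z (yIdx 2) = (q : ℝ)} = 0 := by
    have := Measure.pi_hyperplane (fun _ : Fin (0 + 1 + 2) => (volume : Measure ℝ)) (yIdx 2) (q : ℝ)
    rwa [← volume_pi] at this
  have hcov : volume (s.domain \ (D₁ ∪ D₂)) = 0 := by
    refine measure_mono_null (fun z hz => ?_) hNull
    obtain ⟨hz, hz'⟩ := hz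
    obtain ⟨⟨h1, h2⟩, h3⟩ := (h.mem z).1 hz
    rcases lt_trichotomy (yv z) q with hy | hy | hy
    · exact absurd (Or.inl ((m₁ z).2 ⟨⟨h1, hy⟩, h3⟩)) hz'
    · exact hy
    · exact absurd (Or.inr ((m₂ z).2 ⟨⟨hy, h2⟩, h3⟩)) hz'
  have hrel := of_sub_restrict_sub_restrict s (isSemialgebraic_gDom _ _ _ _) (isSemialgebraic_gDom _ _ _ _)
    hs₁ hs₂ hdisj hcov
  refine good_of_rel3 hrel (h₁ _ ⟨hij, rfl, fun z hz => h.int (hs₁ hz), h.bdd.subset hs₁, hlq, fun y hy1 hy2 =>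
    h.AB y hy1 (hy2.trans hq2), ?_⟩) (h₂ _ ⟨hij, rfl, fun z hz => h.int (hs₂ hz), h.bdd.subset hs₂, hqu,
    fun y hy1 hy2 => h.AB y (hq1.trans hy1) hy2, ?_⟩)
  · exact h.pole.imp_right fun hp => hqu.le.trans hp
  · exact h.pole.imp_left fun hp => hp.trans hlq.le

end RebaseE1

/-- Registered support goal of this file (part `rebaseSimpleZero_HDiff1_of_HPar1`): rule (1a) on a
nest `X < tᵢ < tⱼ < Z` by an intermediate section `Y` (`RebaseE1.three_piece`). -/
theorem rebaseSimpleZero_threePiece (m' : ℕ) (i j : Fin 2) (W : KZ.IntegralRep (0 + 1 + 2)) (M : Fin m' → (Fin (0 + 1) → ℚ) × ℚ) (hij : i ≠ j) (X Y Z : (Fin (0 + 1) → ℚ) × ℚ) (hW : W.domain = SeparatePos.gDom 0 2 m' M (RebaseNest.nlo i X) (RebaseNest.nhi j Z)) (hXY : ∀ y ∈ RebaseZero.cell M, RebaseZero.ev X y ≤ RebaseZero.ev Y y) (hYZ : ∀ y ∈ RebaseZero.cell M, RebaseZero.ev Y y ≤ RebaseZero.ev Z y) : ∃ r₁ r₂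 r₃ : KZ.IntegralRep (0 + 1 + 2), (r₁.domain = SeparatePos.gDom 0 2 m' M (RebaseNest.nlo i X) (RebaseNest.nhi j Y) ∧ r₁.integrand = W.integrand) ∧ (r₂.domain = RebaseZero.pDom M (fun l => if l = i then X else Y) (fun l => if l = i then Y else Z) ∧ r₂.integrand = W.integrand) ∧ (r₃.domain = SeparatePos.gDom 0 2 m' M (RebaseNest.nlo i Y) (RebaseNest.nhi j Z) ∧ r₃.integrand = W.integrand) ∧ KZ.of W - KZ.of r₁ - KZ.of r₂ - KZ.of r₃ ∈ KZ.relations :=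
  RebaseE1.three_piece W M hij X Y Z hW hXY hYZ

end Summit.KontsevichZagierPeriods.ArrangementNormalForm.JanusBands
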